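import Literature.MathematicalPhysics.QuantumFieldTheory.Balaban1983to89.Setup
import HarnessLib

/-!
# `AlphaInputsT3ACv3ModelBox` — START v3 for the (FL) `hLift` binder: **THE MODEL BOX CARRIERS** shared by rows (S2)–(S5) — integer sites `u : Fin d → ℤ`, unit vectors `e μ`, the box
# `InBox R` and its shell, model one-forms and their curl `curlB`, model bond fields and their plaquettes `plaqB` ∕ gauge action `gaugeB`, and the CHART `boxSite c u = c + u` into a
# lattice torus with the pull-back of a gauge field — lane `pub-balaban3d` ∕ cell `ym3-torus`, seat `ym-ust-19936-w1` (g2, LEAD)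

WHY (OWNER RULING 19936 (FL) START 2026-08-28T02:16:33Z: START v3 of record = the section `iterSec k V` with tubes around interior edges and transfinite-filled cubes around interior
vertices; memo `HOME/ym-ust-19936-w1/NONABELIAN-FL-START-w1-g2.md`).  Rows (S1) tube profile (★w2), (S3) boundary axial gauge on a cube (★w5), (S4) transfinite fill (★w3) are TORUS-FREE
statements about functions on `ℤ^d`; row (S5) (this seat) charts them into `Site P j = Fin d → ZMod N` around an actual edge∕vertex of the region.  So that the four rows bind to the SAME
letters, THIS FILE fixes the shared vocabulary once (LEAD post 02:22Z «CARRIERS»):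
* §1 `e μ := Pi.single μ 1`; `InBox R u :↔ ∀ i, |u i| ≤ R`; `OnShell R u :↔ InBox R u ∧ ∃ i, |u i| = R`; algebra of `u + e μ` (`add_e_apply_same/_ne`, `InBox.mono`, …).
* §2 model one-forms `a : (Fin d → ℤ) → Fin d → V` (value on the bond from `u` to `u + e μ`) with `curlB a u μ ν := a u μ + a (u + e μ) ν − a (u + e ν) μ − a u ν` (the tree's
  convention, `AbelianEML.curlAt` ∕ `GaugeField.plaqHol`); `curlB` is additive and kills model gradients `gradB f u μ := f (u + e μ) − f u` (`curlB_gradB`).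
* §3 model bond fields `U : (Fin d → ℤ) → Fin d → G`: `plaqB U u μ ν := U u μ · U (u+e μ) ν · (U (u+e ν) μ)⁻¹ · (U u ν)⁻¹`, `gaugeB g U u μ := g u · U u μ · (g (u + e μ))⁻¹`, and
  `plaqB_gaugeB : plaqB (gaugeB g U) u μ ν = g u · plaqB U u μ ν · (g u)⁻¹` (so `dist1` is invariant, `dist1_plaqB_gaugeB`).
* §4 the chart `boxSite c u : Site P j := fun i ↦ c i + (u i : ZMod _)`: `boxSite_zero`, ★ `boxSite_add_e : boxSite c (u + e μ) = (boxSite c u).shift μ`, `boxSite_add`; the pull-back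
  `pullB c U u μ := U ⟨boxSite c u, μ⟩` with ★★ `plaqHol_boxSite : plaqHol U ⟨boxSite c u, μ, ν, _⟩ = plaqB (pullB c U) u μ ν` and `pullB_gaugeAct : pullB c (U^g) = gaugeB (g ∘ boxSite c)
  (pullB c U)`; injectivity of the chart on `InBox R` when `2R + 1 ≤ N` (`boxSite_injOn`).
Nothing here is specific to d = 3, to SU(2), or to the region; no estimate is made.
HONEST FRAMING.  Bookkeeping definitions + `rfl`-grade lemmas; count-neutral helper toward R3 2′ (items 19936∕19935; `--supports`); (FL)∕`hLift` NOT proved; registry untouched; nothing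
about d = 4, the continuum, or a mass gap; YM₃ on T³ is rung R3, not Clay.

References: T. Bałaban, Commun. Math. Phys. 98 (1985) 17–51 [Balaban1985Averaging] ((5), (8)–(9) pp.18–19: bonds, gauge action, plaquette variables); Commun. Math. Phys. 109 (1987)
249–301 [Balaban1987RG1] ((0.1) p.251: the lattice tori).
-/

set_option autoImplicit false

noncomputable section

namespace Summit.QuantumFields.YangMills.Theorems.ModelBox

open Literature.MathematicalPhysics.QuantumFieldTheory.Balaban1983to89

/-! ## §1 Integer sites, unit vectors, the box and its shell -/

section Sites

variable {d : ℕ}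

/-- The unit vector `e_μ ∈ ℤ^d`. [folklore] -/
def e (μ : Fin d) : Fin d → ℤ := Pi.single μ 1

/-- `(e_μ)_μ = 1`. [folklore] -/
@[simp] theorem e_apply_same (μ : Fin d) : e μ μ = 1 := by simp [e]

/-- `(e_μ)_i = 0` for `i ≠ μ`. [folklore] -/
theorem e_apply_ne {μ i : Fin d} (h : i ≠ μ) : e μ i = 0 := by simp [e, h]

/-- `(u + e_μ)_μ = u_μ + 1`. [folklore] -/
@[simp] theorem add_e_apply_same (u : Fin d → ℤ) (μ : Fin d) : (u + e μ) μ = u μ + 1 := by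
  simp [e]

/-- `(u + e_μ)_i = u_i` for `i ≠ μ`. [folklore] -/
theorem add_e_apply_ne (u : Fin d → ℤ) {μ i : Fin d} (h : i ≠ μ) : (u + e μ) i = u i := by
  simp [e, h]

/-- Unit steps commute: `u + e_μ + e_ν = u + e_ν + e_μ`. [folklore] -/
theorem add_e_comm (u : Fin d → ℤ) (μ ν : Fin d) : u + e μ + e ν = u + e ν + e μ := by
  abel

/-- **THE BOX OF HALF-SIDE `R`**: `|u_i| ≤ R` for every coordinate. [folklore] -/
def InBox (R : ℕ) (u : Fin d → ℤ) : Prop := ∀ i, |u i| ≤ (R : ℤ)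

/-- **THE SHELL (boundary sites) OF THE BOX**: in the box with some coordinate of modulus exactly `R`. [folklore] -/
def OnShell (R : ℕ) (u : Fin d → ℤ) : Prop := InBox R u ∧ ∃ i, |u i| = (R : ℤ)

/-- The origin is in every box. [folklore] -/
theorem inBox_zero (R : ℕ) : InBox R (0 : Fin d → ℤ) := fun i => by simp

/-- Boxes are monotone in the radius. [folklore] -/
theorem InBox.mono {R R' : ℕ} (h : R ≤ R') {u : Fin d → ℤ} (hu : InBox R u) : InBox R' u :=
  fun i => (hu i).trans (by exact_mod_cast h)

/-- Coordinates of a box point lie in `[-R, R]`. [folklore] -/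
theorem InBox.bounds {R : ℕ} {u : Fin d → ℤ} (hu : InBox R u) (i : Fin d) : -(R : ℤ) ≤ u i ∧ u i ≤ R := abs_le.mp (hu i)

/-- A **model bond** `(u, μ)` lies in the box iff both its endpoints do. [folklore] -/
def BondInBox (R : ℕ) (u : Fin d → ℤ) (μ : Fin d) : Prop := InBox R u ∧ InBox R (u + e μ)

/-- A **boundary (tangential) bond**: in the box and lying in a face `x_i = ±R`, `i ≠ μ`. [folklore] -/
def BdryBond (R : ℕ) (u : Fin d → ℤ) (μ : Fin d) : Prop := BondInBox R u μ ∧ ∃ i, i ≠ μ ∧ |u i| = (R : ℤ)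

/-- A **model plaquette** `(u; μ, ν)` lies in the box iff its four corners do. [folklore] -/
def PlaqInBox (R : ℕ) (u : Fin d → ℤ) (μ ν : Fin d) : Prop :=
  InBox R u ∧ InBox R (u + e μ) ∧ InBox R (u + e ν) ∧ InBox R (u + e μ + e ν)

/-- A **boundary plaquette**: in the box and lying in a face `x_i = ±R`, `i ∉ {μ, ν}`. [folklore] -/
def BdryPlaq (R : ℕ) (u : Fin d → ℤ) (μ ν : Fin d) : Prop := PlaqInBox R u μ ν ∧ ∃ i, i ≠ μ ∧ i ≠ ν ∧ |u i| = (R : ℤ)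

/-- A boundary bond is a box bond. [folklore] -/
theorem BdryBond.bondInBox {R : ℕ} {u : Fin d → ℤ} {μ : Fin d} (h : BdryBond R u μ) : BondInBox R u μ := h.1

/-- In a face `x_i = ±R` (`i ≠ μ`) both endpoints of the bond `(u, μ)` have `|x_i| = R`. [folklore] -/
theorem BdryBond.abs_tgt {R : ℕ} {u : Fin d → ℤ} {μ : Fin d} (h : BdryBond R u μ) : ∃ i, i ≠ μ ∧ |(u + e μ) i| = (R : ℤ) := by
  obtain ⟨i, hi, hR⟩ := h.2
  exact ⟨i, hi, by rw [add_e_apply_ne u hi, hR]⟩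

end Sites

/-! ## §2 Model one-forms and their curl -/

section Forms

variable {d : ℕ} {V : Type*} [AddCommGroup V]

/-- **THE MODEL CURL** of a one-form at `(u; μ, ν)`: `a(u,μ) + a(u+e_μ,ν) − a(u+e_ν,μ) − a(u,ν)` — the tree's convention (`AbelianEML.curlAt`, `GaugeField.plaqHol`).
[cite: Balaban1985Averaging, (9) p.19] -/
def curlB (a : (Fin d → ℤ) → Fin d → V) (u : Fin d → ℤ) (μ ν : Fin d) : V :=
  a u μ + a (u + e μ) ν - a (u + e ν) μ - a u ν

/-- **THE MODEL GRADIENT** of a site function: `(df)(u,μ) = f(u+e_μ) − f(u)`. [cite: Balaban1985Averaging, (8) p.19] -/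
def gradB (f : (Fin d → ℤ) → V) (u : Fin d → ℤ) (μ : Fin d) : V := f (u + e μ) - f u

omit [AddCommGroup V] in
/-- `curlB` unfolded. [folklore] -/
theorem curlB_def [AddCommGroup V] (a : (Fin d → ℤ) → Fin d → V) (u : Fin d → ℤ) (μ ν : Fin d) :
    curlB a u μ ν = a u μ + a (u + e μ) ν - a (u + e ν) μ - a u ν := rfl

/-- The curl is additive. [folklore] -/
theorem curlB_add (a b : (Fin d → ℤ) → Fin d → V) (u : Fin d → ℤ) (μ ν : Fin d) :
    curlB (a + b) u μ ν = curlB a u μ ν + curlB b u μ ν := by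
  simp only [curlB, Pi.add_apply]; abel

/-- The curl is compatible with subtraction. [folklore] -/
theorem curlB_sub (a b : (Fin d → ℤ) → Fin d → V) (u : Fin d → ℤ) (μ ν : Fin d) :
    curlB (a - b) u μ ν = curlB a u μ ν - curlB b u μ ν := by
  simp only [curlB, Pi.sub_apply]; abel

/-- The curl is antisymmetric in the directions. [folklore] -/
theorem curlB_swap (a : (Fin d → ℤ) → Fin d → V) (u : Fin d → ℤ) (μ ν : Fin d) : curlB a u ν μ = -curlB a u μ ν := by
  simp only [curlB]; abel

/-- **GRADIENTS ARE CURL-FREE**: `curlB (gradB f) = 0`. [cite: Balaban1985Averaging, (8)–(9) p.19] -/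
theorem curlB_gradB (f : (Fin d → ℤ) → V) (u : Fin d → ℤ) (μ ν : Fin d) : curlB (gradB f) u μ ν = 0 := by
  simp only [curlB, gradB, add_e_comm u μ ν]; abel

/-- The curl is `ℤ`-homogeneous ∕ commutes with scalar action of a ring. [folklore] -/
theorem curlB_smul {S : Type*} [Monoid S] [DistribMulAction S V] (s : S) (a : (Fin d → ℤ) → Fin d → V) (u : Fin d → ℤ) (μ ν : Fin d) :
    curlB (s • a) u μ ν = s • curlB a u μ ν := by
  simp only [curlB, Pi.smul_apply, smul_add, smul_sub]

end Forms

/-! ## §3 Model bond fields: plaquettes and gauge action -/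

section Fields

variable {d : ℕ} {G : Type*} [Group G]

/-- **THE MODEL PLAQUETTE VARIABLE** `U(u,μ)·U(u+e_μ,ν)·U(u+e_ν,μ)⁻¹·U(u,ν)⁻¹`. [cite: Balaban1985Averaging, (9) p.19] -/
def plaqB (U : (Fin d → ℤ) → Fin d → G) (u : Fin d → ℤ) (μ ν : Fin d) : G :=
  U u μ * U (u + e μ) ν * (U (u + e ν) μ)⁻¹ * (U u ν)⁻¹

/-- **THE MODEL GAUGE ACTION** `U^g(u,μ) = g(u)·U(u,μ)·g(u+e_μ)⁻¹`. [cite: Balaban1985Averaging, (8) p.19] -/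
def gaugeB (g : (Fin d → ℤ) → G) (U : (Fin d → ℤ) → Fin d → G) (u : Fin d → ℤ) (μ : Fin d) : G :=
  g u * U u μ * (g (u + e μ))⁻¹

/-- `plaqB` unfolded. [folklore] -/
theorem plaqB_def (U : (Fin d → ℤ) → Fin d → G) (u : Fin d → ℤ) (μ ν : Fin d) :
    plaqB U u μ ν = U u μ * U (u + e μ) ν * (U (u + e ν) μ)⁻¹ * (U u ν)⁻¹ := rfl

/-- `gaugeB` unfolded. [folklore] -/
theorem gaugeB_def (g : (Fin d → ℤ) → G) (U : (Fin d → ℤ) → Fin d → G) (u : Fin d → ℤ) (μ : Fin d) :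
    gaugeB g U u μ = g u * U u μ * (g (u + e μ))⁻¹ := rfl

/-- **GAUGE COVARIANCE OF THE MODEL PLAQUETTE**: `(U^g)(∂p) = g(u)·U(∂p)·g(u)⁻¹`. [cite: Balaban1985Averaging, (12) p.19] -/
theorem plaqB_gaugeB (g : (Fin d → ℤ) → G) (U : (Fin d → ℤ) → Fin d → G) (u : Fin d → ℤ) (μ ν : Fin d) :
    plaqB (gaugeB g U) u μ ν = g u * plaqB U u μ ν * (g u)⁻¹ := by
  simp only [plaqB, gaugeB, add_e_comm u μ ν]
  group

/-- The trivial model field has trivial plaquettes. [folklore] -/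
theorem plaqB_one (u : Fin d → ℤ) (μ ν : Fin d) : plaqB (fun (_ : Fin d → ℤ) (_ : Fin d) => (1 : G)) u μ ν = 1 := by
  simp [plaqB]

/-- A pure gauge `g(u)·g(u+e_μ)⁻¹` is flat. [cite: Balaban1985Averaging, (12) p.19] -/
theorem plaqB_pureGauge (g : (Fin d → ℤ) → G) (u : Fin d → ℤ) (μ ν : Fin d) :
    plaqB (fun v κ => g v * (g (v + e κ))⁻¹) u μ ν = 1 := by
  have : (fun v κ => g v * (g (v + e κ))⁻¹) = gaugeB g (fun (_ : Fin d → ℤ) (_ : Fin d) => (1 : G)) := by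
    funext v κ; simp [gaugeB]
  rw [this, plaqB_gaugeB, plaqB_one, mul_one, mul_inv_cancel]

/-- `dist1` of model plaquettes is gauge invariant. [cite: Balaban1985Averaging, (12) p.19] -/
theorem dist1_plaqB_gaugeB {G : Type*} [GaugeGroup G] (g : (Fin d → ℤ) → G) (U : (Fin d → ℤ) → Fin d → G) (u : Fin d → ℤ) (μ ν : Fin d) :
    GaugeGroup.dist1 (plaqB (gaugeB g U) u μ ν) = GaugeGroup.dist1 (plaqB U u μ ν) := by
  rw [plaqB_gaugeB, GaugeGroup.dist1_conj]

end Fields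

/-! ## §4 The chart into a lattice torus and the pull-back of a gauge field -/

section Chart

variable {P : Params} {j : ℕ}

/-- **THE CHART** `u ↦ c + u` from `ℤ^d` to the torus `T^{(j)}`, centred at `c`. [cite: Balaban1987RG1, (0.1) p.251] -/
def boxSite (c : Site P j) (u : Fin P.d → ℤ) : Site P j := fun i => c i + ((u i : ℤ) : ZMod (P.sitesPerDir j))

/-- The chart sends `0` to its centre. [folklore] -/
@[simp] theorem boxSite_zero (c : Site P j) : boxSite c 0 = c := by
  funext i; simp [boxSite]

/-- The chart is additive in `u`. [folklore] -/
theorem boxSite_add (c : Site P j) (u v : Fin P.d → ℤ) : boxSite c (u + v) = boxSite (boxSite c u) v := by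
  funext i; simp [boxSite, add_assoc]

/-- **★ A UNIT STEP IN THE MODEL IS A UNIT STEP ON THE TORUS**: `boxSite c (u + e_μ) = (boxSite c u) + e_μ`. [folklore] -/
theorem boxSite_add_e (c : Site P j) (u : Fin P.d → ℤ) (μ : Fin P.d) : boxSite c (u + e μ) = (boxSite c u).shift μ := by
  funext i
  by_cases h : i = μ
  · subst h
    simp [boxSite, Site.shift, add_assoc]
  · simp [boxSite, Site.shift, Function.update_of_ne h, e_apply_ne h]

/-- Two steps. [folklore] -/
theorem boxSite_add_e_add_e (c : Site P j) (u : Fin P.d → ℤ) (μ ν : Fin P.d) :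
    boxSite c (u + e μ + e ν) = ((boxSite c u).shift μ).shift ν := by
  rw [boxSite_add_e, boxSite_add_e]

variable {G : Type*}

/-- **THE PULL-BACK** of a torus bond field along the chart: `(pullB c U)(u, μ) = U ⟨c + u, μ⟩`. [cite: Balaban1985Averaging, (5) p.18] -/
def pullB (c : Site P j) (U : GaugeField P j G) : (Fin P.d → ℤ) → Fin P.d → G := fun u μ => U ⟨boxSite c u, μ⟩

/-- `pullB` unfolded. [folklore] -/
theorem pullB_apply (c : Site P j) (U : GaugeField P j G) (u : Fin P.d → ℤ) (μ : Fin P.d) : pullB c U u μ = U ⟨boxSite c u, μ⟩ := rfl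

/-- **★★ TORUS PLAQUETTES ARE MODEL PLAQUETTES OF THE PULL-BACK**: `U(∂⟨c+u; μ, ν⟩) = plaqB (pullB c U) u μ ν`. [cite: Balaban1985Averaging, (9) p.19] -/
theorem plaqHol_boxSite [GaugeGroup G] (c : Site P j) (U : GaugeField P j G) (u : Fin P.d → ℤ) {μ ν : Fin P.d} (hμν : μ < ν) :
    GaugeField.plaqHol U ⟨boxSite c u, μ, ν, hμν⟩ = plaqB (pullB c U) u μ ν := by
  simp only [GaugeField.plaqHol, plaqB, pullB, boxSite_add_e]

/-- **THE PULL-BACK INTERTWINES THE GAUGE ACTIONS**: `pullB c (U^g) = gaugeB (g ∘ boxSite c) (pullB c U)`. [cite: Balaban1985Averaging, (8) p.19] -/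
theorem pullB_gaugeAct [GaugeGroup G] (c : Site P j) (g : GaugeTransf P j G) (U : GaugeField P j G) :
    pullB c (GaugeField.gaugeAct g U) = gaugeB (g ∘ boxSite c) (pullB c U) := by
  funext u μ
  simp only [pullB, GaugeField.gaugeAct, gaugeB, Function.comp_apply, PBond.tgt, boxSite_add_e]

/-- Two box points with the same image have coordinates congruent modulo the torus size. [folklore] -/
theorem intCast_eq_of_boxSite_eq {c : Site P j} {u v : Fin P.d → ℤ} (h : boxSite c u = boxSite c v) (i : Fin P.d) :
    ((u i : ℤ) : ZMod (P.sitesPerDir j)) = ((v i : ℤ) : ZMod (P.sitesPerDir j)) := by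
  have := congrFun h i
  simpa [boxSite] using this

/-- **THE CHART IS INJECTIVE ON THE BOX** once the box fits into the torus: `2R + 1 ≤ N`. [folklore] -/
theorem boxSite_injOn (c : Site P j) {R : ℕ} (hR : 2 * R + 1 ≤ P.sitesPerDir j) {u v : Fin P.d → ℤ}
    (hu : InBox R u) (hv : InBox R v) (h : boxSite c u = boxSite c v) : u = v := by
  funext i
  have hc := intCast_eq_of_boxSite_eq h i
  rw [ZMod.intCast_eq_intCast_iff_dvd_sub] at hc
  obtain ⟨hu1, hu2⟩ := hu.bounds i
  obtain ⟨hv1, hv2⟩ := hv.bounds i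
  have hN : (2 * R + 1 : ℤ) ≤ (P.sitesPerDir j : ℤ) := by exact_mod_cast hR
  have habs : |v i - u i| < (P.sitesPerDir j : ℤ) := by
    rw [abs_lt]; constructor <;> linarith
  have h0 : v i - u i = 0 := Int.eq_zero_of_abs_lt_dvd hc habs
  linarith

end Chart

end Summit.QuantumFields.YangMills.Theorems.ModelBox

end
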